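import Summits.Ventures.Crystal3D.Theorems.StickyWulffConstantGenericWallFloorBarlowZigCovFramesApart
import Summits.Ventures.Crystal3D.Theorems.StickyWulffConstantTextureLiminfLineCountGlue
import HarnessLib

/-!
# TexShadow §2c — the ON-REACH part SPLIT BY NAME: zig-apart (closed modulo E1) ∪ shared lattice ∪ twin lattice ∪ coaxial frames ∪ weak zig,
# with the PROVED composition (lane T, crux `TextureLiminf`, stmt-Ventures-19483; registered line `TexShadow` v6.15; cf-p1 g29 21:46:23Z (1))

HONEST FRAMING. Venture `Summits/Ventures/Crystal3D` (cell `crystal3d-full`), helper `--supports` the crux `TextureLiminf`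
(stmt-Ventures-19483) of `route-Ventures-StickyWulffConstant`, registered line `TexShadow`.  Rung credit only; F-C1 not moved.
Definitions (named sub-parts of `stub_bilayerWallOnReachAll : ∃ R, BilayerWallOnReachAllFrom FramesApart R`) + proved glue + ONE sub-part
closed modulo E1/StarPairFar; nothing else is claimed.

THE SPLIT.  The on-reach hypothesis is `(ΔSteep₁ ∧ ΔSteep₂ ∧ FluxDominated c ∧ ¬BarlowOffReach) ∨ (RowMixDominated c ∧ ¬FramesApart)`.
With the row-covered part (CLOSED, v6.15) and `DomBy c := (ZigGood₁ ∧ ZigGood₂ ∧ FluxDominated c) ∨ RowMixDominated c` («dominated by the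
corner of record»), pure logic leaves exactly:
* `BilayerWallZigApart` — `ZigGood₁ ∧ ZigGood₂ ∧ FramesApart`, flux-dominated tables: **CLOSED here modulo E1/StarPairFar**
  (`bilayerWallZigApartFrom_of_cert`, `R = 6`) from lane G's `barlow_hlines_framesApart` (19480-p2 g8, p670599 ✓) and T's `bilayerWallAt_of_lineCount`
  (p648386 ✓) — the positional on-reach zig pairs that are frame-generic (R46's o000 / ψ = 0 translation coincidences) are thereby PAID;
* `BilayerWallOnReachShared` (O1) — `DomBy c` and some corner frame of one family carries the OTHER PLATE'S bilayer lattice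
  (`F·Λ₀ = L₂·Λ₀`): the two plates continue one Barlow crystal orientation across the cell — a translation / antiphase wall of a common frame or no
  wall; owner: lane F's `CoaxialWallLaw` (translation rows) imported as a HYPOTHESIS, or the table's own slack (equal bilayer lattices ⇒ `c = 0`,
  `…ZeroTable`); needs `c₁ = ½` as typed (admissible tables are capped at `½·sin∠(m, e₃)` on co-axial strip pairs; an L-1 re-typing of
  `BilayerChargeAdmissible` to `2√6/9` raises it accordingly);
* `BilayerWallOnReachTwin` (O2) — `DomBy c` and some corner frame carries the other plate's BASAL-TWIN lattice (`F·Λ₀ = L₂′·Λ₀`): a coherent twin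
  wall of a common axis; owner: `CoaxialWallLaw` (twin rows) as a hypothesis; `c₁ = ½` as typed;
* `BilayerWallOnReachCoaxial` (O3) — `DomBy c` and two corner frames are Barlow-coaxial (`CoAxFrames`), neither lattice shared: registered
  translation/twin walls of a common axis (R45's binding ψ = 0 half-cell translation wall, truth/charge ≥ 3.6) — owner: `CoaxialWallLaw` or lane G's
  registered accounting (`GenericWallFloorRegisteredResidualWide`-type import); `c₁ = ½` as typed;
* `BilayerWallOnReachWeakZig` (W) — both plates Δ-steep, table flux-dominated but NOT row-mix-dominated, reach-obstructed, and some plate NOT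
  `ZigGood` (a bilayer rising `< √2/2`): the corner of record runs rows there, so neither F4 applies; expected owner: (L3) with deficit-MIN, or a
  G lemma «Δ-steep ∧ flux-dominated ⇒ ZigGood on the paying strips».
* **`bilayerWallOnReachAll_of_split`** — RowCov ∪ ZigApart ∪ O1 ∪ O2 ∪ O3 ∪ W ⇒ `BilayerWallOnReachAllFrom FramesApart (max …)` (PROVED, pure logic:
  `¬FramesApart` unfolds into the three classes; `¬RowMixDominated` forces the zig disjunct).
WHAT THIS IS NOT: O1–O3 and W are NOT proved; no import of `CoaxialWallLaw`'s proof; which `c₁` the F law finally certifies is lane F's; F-C1 not moved.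
-/

noncomputable section

open scoped BigOperators InnerProductSpace ENNReal
open MeasureTheory Filter

namespace Summit.Ventures.Crystal3D.Cruxes.TextureLiminf.TexShadow

open Summit.Ventures.Crystal3D Summit.Ventures.Crystal3D.Theorems
open Literature.MathematicalPhysics.StatisticalMechanics (IsHaggSeq fccStacking)

/-! ## Domination by the corner of record -/

/-- The table `c` is DOMINATED BY THE CORNER OF RECORD of the pair: both plates zig-good and `c` flux-dominated, or `c` row-mix-dominated
(thresholds `√2/2`). -/
def DomBy (L₁ : E3 ≃ₗᵢ[ℝ] E3) (σ₁ : ℤ → ℤ) (L₂ : E3 ≃ₗᵢ[ℝ] E3) (σ₂ : ℤ → ℤ) (c : ℤ → ℤ → ℝ) : Prop :=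
  (ZigGood L₁ σ₁ e₃ ∧ ZigGood L₂ σ₂ (-e₃) ∧ FluxDominated (Real.sqrt 2 / 2) L₁ σ₁ L₂ σ₂ c) ∨
    RowMixDominated (Real.sqrt 2 / 2) L₁ σ₁ L₂ σ₂ c

/-! ## The five named sub-parts -/

/-- **ZIG-APART PART** at `(C, R₀)`: both plates zig-good, corner frames apart, flux-dominated admissible tables. -/
def BilayerWallZigApart (C R₀ : ℝ) : Prop :=
  ∀ (σ₁ σ₂ : ℤ → ℤ), IsHaggSeq σ₁ → IsHaggSeq σ₂ →
    ∀ (L₁ L₂ : E3 ≃ₗᵢ[ℝ] E3) (s₁ s₂ : E3) (A₁ A₂ : ℤ → (E3 ≃ₗᵢ[ℝ] E3)) (u₁ u₂ : ℤ → E3),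
    BilayerFramesAt L₁ s₁ σ₁ A₁ u₁ → BilayerFramesAt L₂ s₂ σ₂ A₂ u₂ →
    (∀ i j : ℤ, ¬ InResidualClass (A₁ i) (A₂ j) (u₁ i) (u₂ j)) →
    ZigGood L₁ σ₁ e₃ → ZigGood L₂ σ₂ (-e₃) → FramesApart L₁ s₁ σ₁ L₂ s₂ σ₂ →
    ∀ (c : ℤ → ℤ → ℝ) (m : ℤ → ℤ → E3), BilayerChargeAdmissible A₁ A₂ c m →
      FluxDominated (Real.sqrt 2 / 2) L₁ σ₁ L₂ σ₂ c →
      BilayerWallAt C R₀ σ₁ σ₂ L₁ L₂ s₁ s₂ c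

/-- **ON-REACH, SHARED LATTICE (O1)** at `(C, R₀)`: dominated table, and some corner frame of one family carries the other plate's bilayer
lattice. -/
def BilayerWallOnReachShared (C R₀ : ℝ) : Prop :=
  ∀ (σ₁ σ₂ : ℤ → ℤ), IsHaggSeq σ₁ → IsHaggSeq σ₂ →
    ∀ (L₁ L₂ : E3 ≃ₗᵢ[ℝ] E3) (s₁ s₂ : E3) (A₁ A₂ : ℤ → (E3 ≃ₗᵢ[ℝ] E3)) (u₁ u₂ : ℤ → E3),
    BilayerFramesAt L₁ s₁ σ₁ A₁ u₁ → BilayerFramesAt L₂ s₂ σ₂ A₂ u₂ →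
    (∀ i j : ℤ, ¬ InResidualClass (A₁ i) (A₂ j) (u₁ i) (u₂ j)) →
    ∀ (c : ℤ → ℤ → ℝ) (m : ℤ → ℤ → E3), BilayerChargeAdmissible A₁ A₂ c m → DomBy L₁ σ₁ L₂ σ₂ c →
      ((∃ F ∈ cornerFrames L₁ σ₁ e₃, F '' fccStacking 1 (Real.sqrt (2 / 3)) = L₂ '' fccStacking 1 (Real.sqrt (2 / 3))) ∨
        (∃ F ∈ cornerFrames L₂ σ₂ (-e₃), F '' fccStacking 1 (Real.sqrt (2 / 3)) = L₁ '' fccStacking 1 (Real.sqrt (2 / 3)))) →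
      BilayerWallAt C R₀ σ₁ σ₂ L₁ L₂ s₁ s₂ c

/-- **ON-REACH, TWIN LATTICE (O2)** at `(C, R₀)`: dominated table, and some corner frame of one family carries the other plate's
BASAL-TWIN lattice. -/
def BilayerWallOnReachTwin (C R₀ : ℝ) : Prop :=
  ∀ (σ₁ σ₂ : ℤ → ℤ), IsHaggSeq σ₁ → IsHaggSeq σ₂ →
    ∀ (L₁ L₂ : E3 ≃ₗᵢ[ℝ] E3) (s₁ s₂ : E3) (A₁ A₂ : ℤ → (E3 ≃ₗᵢ[ℝ] E3)) (u₁ u₂ : ℤ → E3),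
    BilayerFramesAt L₁ s₁ σ₁ A₁ u₁ → BilayerFramesAt L₂ s₂ σ₂ A₂ u₂ →
    (∀ i j : ℤ, ¬ InResidualClass (A₁ i) (A₂ j) (u₁ i) (u₂ j)) →
    ∀ (c : ℤ → ℤ → ℝ) (m : ℤ → ℤ → E3), BilayerChargeAdmissible A₁ A₂ c m → DomBy L₁ σ₁ L₂ σ₂ c →
      ((∃ F ∈ cornerFrames L₁ σ₁ e₃,
          F '' fccStacking 1 (Real.sqrt (2 / 3)) = (twinFrame L₂ (L₂ e₃)) '' fccStacking 1 (Real.sqrt (2 / 3))) ∨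
        (∃ F ∈ cornerFrames L₂ σ₂ (-e₃),
          F '' fccStacking 1 (Real.sqrt (2 / 3)) = (twinFrame L₁ (L₁ e₃)) '' fccStacking 1 (Real.sqrt (2 / 3)))) →
      BilayerWallAt C R₀ σ₁ σ₂ L₁ L₂ s₁ s₂ c

/-- **ON-REACH, COAXIAL FRAMES (O3)** at `(C, R₀)`: dominated table, and a corner frame of family 1 is Barlow-coaxial with a corner frame of
family 2. -/
def BilayerWallOnReachCoaxial (C R₀ : ℝ) : Prop :=
  ∀ (σ₁ σ₂ : ℤ → ℤ), IsHaggSeq σ₁ → IsHaggSeq σ₂ →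
    ∀ (L₁ L₂ : E3 ≃ₗᵢ[ℝ] E3) (s₁ s₂ : E3) (A₁ A₂ : ℤ → (E3 ≃ₗᵢ[ℝ] E3)) (u₁ u₂ : ℤ → E3),
    BilayerFramesAt L₁ s₁ σ₁ A₁ u₁ → BilayerFramesAt L₂ s₂ σ₂ A₂ u₂ →
    (∀ i j : ℤ, ¬ InResidualClass (A₁ i) (A₂ j) (u₁ i) (u₂ j)) →
    ∀ (c : ℤ → ℤ → ℝ) (m : ℤ → ℤ → E3), BilayerChargeAdmissible A₁ A₂ c m → DomBy L₁ σ₁ L₂ σ₂ c →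
      (∃ F₁ ∈ cornerFrames L₁ σ₁ e₃, ∃ F₂ ∈ cornerFrames L₂ σ₂ (-e₃), CoAxFrames F₁ F₂) →
      BilayerWallAt C R₀ σ₁ σ₂ L₁ L₂ s₁ s₂ c

/-- **ON-REACH, WEAK ZIG (W)** at `(C, R₀)`: both plates Δ-steep, table flux-dominated but not row-mix-dominated, family pair NOT Barlow
off-reach, and some plate not zig-good. -/
def BilayerWallOnReachWeakZig (C R₀ : ℝ) : Prop :=
  ∀ (σ₁ σ₂ : ℤ → ℤ), IsHaggSeq σ₁ → IsHaggSeq σ₂ →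
    ∀ (L₁ L₂ : E3 ≃ₗᵢ[ℝ] E3) (s₁ s₂ : E3) (A₁ A₂ : ℤ → (E3 ≃ₗᵢ[ℝ] E3)) (u₁ u₂ : ℤ → E3),
    BilayerFramesAt L₁ s₁ σ₁ A₁ u₁ → BilayerFramesAt L₂ s₂ σ₂ A₂ u₂ →
    (∀ i j : ℤ, ¬ InResidualClass (A₁ i) (A₂ j) (u₁ i) (u₂ j)) →
    ∀ (c : ℤ → ℤ → ℝ) (m : ℤ → ℤ → E3), BilayerChargeAdmissible A₁ A₂ c m →
      DeltaSteep L₁ e₃ → DeltaSteep L₂ (-e₃) → FluxDominated (Real.sqrt 2 / 2) L₁ σ₁ L₂ σ₂ c →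
      ¬ BarlowOffReach L₁ s₁ σ₁ L₂ s₂ σ₂ → ¬ RowMixDominated (Real.sqrt 2 / 2) L₁ σ₁ L₂ σ₂ c →
      ¬ (ZigGood L₁ σ₁ e₃ ∧ ZigGood L₂ σ₂ (-e₃)) →
      BilayerWallAt C R₀ σ₁ σ₂ L₁ L₂ s₁ s₂ c

/-- `From` form of the zig-apart part. -/
def BilayerWallZigApartFrom (R : ℝ) : Prop := ∀ R₀ : ℝ, R ≤ R₀ → ∃ C : ℝ, BilayerWallZigApart C R₀
/-- `From` form of O1. -/
def BilayerWallOnReachSharedFrom (R : ℝ) : Prop := ∀ R₀ : ℝ, R ≤ R₀ → ∃ C : ℝ, BilayerWallOnReachShared C R₀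
/-- `From` form of O2. -/
def BilayerWallOnReachTwinFrom (R : ℝ) : Prop := ∀ R₀ : ℝ, R ≤ R₀ → ∃ C : ℝ, BilayerWallOnReachTwin C R₀
/-- `From` form of O3. -/
def BilayerWallOnReachCoaxialFrom (R : ℝ) : Prop := ∀ R₀ : ℝ, R ≤ R₀ → ∃ C : ℝ, BilayerWallOnReachCoaxial C R₀
/-- `From` form of W. -/
def BilayerWallOnReachWeakZigFrom (R : ℝ) : Prop := ∀ R₀ : ℝ, R ≤ R₀ → ∃ C : ℝ, BilayerWallOnReachWeakZig C R₀

/-! ## The zig-apart part is closed modulo E1 / StarPairFar -/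

/-- **ZIG-APART PART from thickness `6`, modulo E1 (`hsE`, `hcert`) and the `StarPairFar` facts (`hDS`, `hCP`)**: lane G's frame-keyed zig
corner `barlow_hlines_framesApart` fed into T's `bilayerWallAt_of_lineCount`. -/
theorem bilayerWallZigApartFrom_of_cert
    {sE : E3} (hsE : sE ∈ fccSlots) (hcert : ExactOnly 0 (fccSlots.filter fun w => 0 < ⟪w, sE⟫_ℝ))
    (hDS : ∀ F₁ F₂ : E3 ≃ₗᵢ[ℝ] E3, DoubleStarCoaxialAt F₁ F₂) (hCP : CapPairCoaxial) :
    BilayerWallZigApartFrom 6 := by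
  intro R₀ hR₀
  refine ⟨((318 + 192 * R₀) + 80 * (R₀ + 9) + 3456 + 1152 * (R₀ + 1)) / 2, ?_⟩
  intro σ₁ σ₂ hσ₁ hσ₂ L₁ L₂ s₁ s₂ A₁ A₂ u₁ u₂ _ _ _ hZ₁ hZ₂ hFA c m hadm hFD
  obtain ⟨step₁, step₂, hsel₁, hsel₂, hF4⟩ :=
    barlow_hlines_framesApart hsE hcert hDS hCP R₀ hR₀ hσ₁ hσ₂ L₁ L₂ s₁ s₂ hZ₁ hZ₂ hFA
  exact bilayerWallAt_of_lineCount hσ₁ hσ₂ L₁ L₂ s₁ s₂ (Real.sqrt 2 / 2) R₀ (318 + 192 * R₀) (by linarith) c hadm.1 hFD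
    hsel₁ hsel₂ hF4

/-! ## The composition -/

/-- `¬ FramesApart` unfolds into the three frame classes. -/
theorem frameClasses_of_not_framesApart {L₁ L₂ : E3 ≃ₗᵢ[ℝ] E3} {s₁ s₂ : E3} {σ₁ σ₂ : ℤ → ℤ}
    (h : ¬ FramesApart L₁ s₁ σ₁ L₂ s₂ σ₂) :
    ((∃ F ∈ cornerFrames L₁ σ₁ e₃, F '' fccStacking 1 (Real.sqrt (2 / 3)) = L₂ '' fccStacking 1 (Real.sqrt (2 / 3))) ∨
      (∃ F ∈ cornerFrames L₂ σ₂ (-e₃), F '' fccStacking 1 (Real.sqrt (2 / 3)) = L₁ '' fccStacking 1 (Real.sqrt (2 / 3)))) ∨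
    ((∃ F ∈ cornerFrames L₁ σ₁ e₃,
        F '' fccStacking 1 (Real.sqrt (2 / 3)) = (twinFrame L₂ (L₂ e₃)) '' fccStacking 1 (Real.sqrt (2 / 3))) ∨
      (∃ F ∈ cornerFrames L₂ σ₂ (-e₃),
        F '' fccStacking 1 (Real.sqrt (2 / 3)) = (twinFrame L₁ (L₁ e₃)) '' fccStacking 1 (Real.sqrt (2 / 3)))) ∨
    (∃ F₁ ∈ cornerFrames L₁ σ₁ e₃, ∃ F₂ ∈ cornerFrames L₂ σ₂ (-e₃), CoAxFrames F₁ F₂) := by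
  by_contra hno
  push Not at hno
  obtain ⟨⟨h1a, h1b⟩, ⟨h2a, h2b⟩, h3⟩ := hno
  exact h ⟨fun F hF => ⟨h1a F hF, h2a F hF⟩, fun F hF => ⟨h1b F hF, h2b F hF⟩, fun F₁ hF₁ F₂ hF₂ => h3 F₁ hF₁ F₂ hF₂⟩

/-- **Glue: row-covered ∪ zig-apart ∪ shared ∪ twin ∪ coaxial ∪ weak-zig ⇒ on-reach** (the v6.15 stub `stub_bilayerWallOnReachAll`'s
statement from the five named sub-parts and the CLOSED row-covered part). -/
theorem bilayerWallOnReachAll_of_split {R_R R_Z R_S R_T R_C R_W : ℝ} (hR1 : 1 ≤ R_R)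
    (hR : BilayerWallRowCovFrom FramesApart R_R) (hZ : BilayerWallZigApartFrom R_Z)
    (hS : BilayerWallOnReachSharedFrom R_S) (hT : BilayerWallOnReachTwinFrom R_T)
    (hC : BilayerWallOnReachCoaxialFrom R_C) (hW : BilayerWallOnReachWeakZigFrom R_W) :
    BilayerWallOnReachAllFrom FramesApart (max (max R_R R_Z) (max (max R_S R_T) (max R_C R_W))) := by
  classical
  intro R₀ hR₀
  have hle : ∀ x : ℝ, x ≤ max (max R_R R_Z) (max (max R_S R_T) (max R_C R_W)) → x ≤ R₀ := fun x hx => hx.trans hR₀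
  obtain ⟨C₁, hC₁⟩ := hR R₀ (hle _ (le_trans (le_max_left _ _) (le_max_left _ _)))
  obtain ⟨C₂, hC₂⟩ := hZ R₀ (hle _ (le_trans (le_max_right _ _) (le_max_left _ _)))
  obtain ⟨C₃, hC₃⟩ := hS R₀ (hle _ (le_trans (le_trans (le_max_left _ _) (le_max_left _ _)) (le_max_right _ _)))
  obtain ⟨C₄, hC₄⟩ := hT R₀ (hle _ (le_trans (le_trans (le_max_right _ _) (le_max_left _ _)) (le_max_right _ _)))
  obtain ⟨C₅, hC₅⟩ := hC R₀ (hle _ (le_trans (le_trans (le_max_left _ _) (le_max_right _ _)) (le_max_right _ _)))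
  obtain ⟨C₆, hC₆⟩ := hW R₀ (hle _ (le_trans (le_trans (le_max_right _ _) (le_max_right _ _)) (le_max_right _ _)))
  have hR₀0 : 0 ≤ R₀ := by linarith [hle _ (le_trans (le_max_left _ _) (le_max_left _ _))]
  set C : ℝ := max (max C₁ C₂) (max (max C₃ C₄) (max C₅ C₆)) with hCdef
  have e1 : C₁ ≤ C := le_trans (le_max_left _ _) (le_max_left _ _)
  have e2 : C₂ ≤ C := le_trans (le_max_right _ _) (le_max_left _ _)
  have e3 : C₃ ≤ C := le_trans (le_trans (le_max_left _ _) (le_max_left _ _)) (le_max_right _ _)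
  have e4 : C₄ ≤ C := le_trans (le_trans (le_max_right _ _) (le_max_left _ _)) (le_max_right _ _)
  have e5 : C₅ ≤ C := le_trans (le_trans (le_max_left _ _) (le_max_right _ _)) (le_max_right _ _)
  have e6 : C₆ ≤ C := le_trans (le_trans (le_max_right _ _) (le_max_right _ _)) (le_max_right _ _)
  refine ⟨C, ?_⟩
  intro σ₁ σ₂ hσ₁ hσ₂ L₁ L₂ s₁ s₂ A₁ A₂ u₁ u₂ hu₁ hu₂ hgen c m hadm H
  -- the three frame classes, for a dominated table
  have classes : DomBy L₁ σ₁ L₂ σ₂ c → ¬ FramesApart L₁ s₁ σ₁ L₂ s₂ σ₂ → BilayerWallAt C R₀ σ₁ σ₂ L₁ L₂ s₁ s₂ c := by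
    intro hdom hFA
    rcases frameClasses_of_not_framesApart hFA with h | h | h
    · exact bilayerWallAt_mono hR₀0 e3 (hC₃ σ₁ σ₂ hσ₁ hσ₂ L₁ L₂ s₁ s₂ A₁ A₂ u₁ u₂ hu₁ hu₂ hgen c m hadm hdom h)
    · exact bilayerWallAt_mono hR₀0 e4 (hC₄ σ₁ σ₂ hσ₁ hσ₂ L₁ L₂ s₁ s₂ A₁ A₂ u₁ u₂ hu₁ hu₂ hgen c m hadm hdom h)
    · exact bilayerWallAt_mono hR₀0 e5 (hC₅ σ₁ σ₂ hσ₁ hσ₂ L₁ L₂ s₁ s₂ A₁ A₂ u₁ u₂ hu₁ hu₂ hgen c m hadm hdom h)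
  by_cases hRow : RowMixDominated (Real.sqrt 2 / 2) L₁ σ₁ L₂ σ₂ c
  · by_cases hFA : FramesApart L₁ s₁ σ₁ L₂ s₂ σ₂
    · exact bilayerWallAt_mono hR₀0 e1 (hC₁ σ₁ σ₂ hσ₁ hσ₂ L₁ L₂ s₁ s₂ A₁ A₂ u₁ u₂ hu₁ hu₂ hgen c m hadm hRow hFA)
    · exact classes (Or.inr hRow) hFA
  · rcases H with ⟨hS₁, hS₂, hFD, hBOR⟩ | ⟨hRow', -⟩
    · by_cases hZG : ZigGood L₁ σ₁ e₃ ∧ ZigGood L₂ σ₂ (-e₃)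
      · by_cases hFA : FramesApart L₁ s₁ σ₁ L₂ s₂ σ₂
        · exact bilayerWallAt_mono hR₀0 e2
            (hC₂ σ₁ σ₂ hσ₁ hσ₂ L₁ L₂ s₁ s₂ A₁ A₂ u₁ u₂ hu₁ hu₂ hgen hZG.1 hZG.2 hFA c m hadm hFD)
        · exact classes (Or.inl ⟨hZG.1, hZG.2, hFD⟩) hFA
      · exact bilayerWallAt_mono hR₀0 e6
          (hC₆ σ₁ σ₂ hσ₁ hσ₂ L₁ L₂ s₁ s₂ A₁ A₂ u₁ u₂ hu₁ hu₂ hgen c m hadm hS₁ hS₂ hFD hBOR hRow hZG)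
    · exact absurd hRow' hRow

end Summit.Ventures.Crystal3D.Cruxes.TextureLiminf.TexShadow

end
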